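import Literature.AlgebraicTopology.KTheory.BottClutching
import Mathlib.Topology.ContinuousMap.StoneWeierstrass
import Mathlib.Topology.UniformSpace.Matrix
import Mathlib.Analysis.SpecificLimits.Normed
import HarnessLib

/-!
# Laurent polynomial approximation of clutching functions (Husemöller, *Fibre Bundles*, Ch. 11, 2.4–2.6)

* `zU` — the coordinate `z` as a unit of `C(X × S¹, ℂ)`; `IsLaurent f` — `f = ∑ᵢ aᵢ(x) z^{eᵢ}` with
  `aᵢ ∈ C(X, ℂ)`, `eᵢ ∈ ℤ`; these form a star subalgebra `laurentStarSubalgebra X` separating the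
  points of `X × S¹` (`X` compact Hausdorff), hence dense by the complex Stone–Weierstrass theorem:
  `exists_isLaurent_near`; matrix version `exists_laurentMatrix_near` for the operator norm
  (Husemöller 11 Prop. 2.5);
* `ClutchingFn.perturb` — a clutching function `u` of `ζ` perturbed by `δ = Z δ Z` with
  `‖v‖ ‖δ‖ < 1` is again a clutching function (Neumann series in the Banach algebra
  `Mₙ(C(X × S¹, ℂ))`); the linear homotopy `u + s δ` over `X × [0,1]` (`ClutchingFn.linearHomotopy`)
  shows `bottClass_perturb : [ζ, u + δ] = [ζ, u]` (Husemöller 11 Prop. 2.6 with homotopy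
  invariance), and finally `ClutchingFn.exists_laurent_bottClass_eq`: every clutching function has
  the Bott class of a Laurent polynomial clutching function `Z (∑ z^{eᵢ} Aᵢ(x)) Z`.

Everything is proved; no named facts.

## References

* D. Husemöller, *Fibre Bundles*, 3rd ed. (1994) [HusemollerFibreBundles1994]: Ch. 11 Def. 2.4,
  Props. 2.5, 2.6.
-/

noncomputable section

open Set Metric unitInterval

namespace Literature.AlgebraicTopology.KTheory

open Literature.RingTheory.KTheory Matrix

universe u

variable {X : Type u} [TopologicalSpace X]

/-! ### The unit `z` and Laurent polynomials `∑ aₖ(x) zᵏ` on `X × S¹` -/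

/-- The coordinate `z` as a unit of `C(X × S¹, ℂ)` (inverse `z̄`). [cite: HusemollerFibreBundles1994, Ch. 11 Notation 2.1] -/
def zU : (C(↥(pieceUp X ∩ pieceDn X), ℂ))ˣ := ⟨zA, zAbar, zA_mul_zAbar, zAbar_mul_zA⟩

/-- Auxiliary statement for Laurent approximation of clutching functions. [folklore] -/
@[simp] theorem val_zU : ((zU : (C(↥(pieceUp X ∩ pieceDn X), ℂ))ˣ) : C(↥(pieceUp X ∩ pieceDn X), ℂ)) = zA := rfl
/-- Auxiliary statement for Laurent approximation of clutching functions. [folklore] -/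
@[simp] theorem val_zU_inv : ((zU⁻¹ : (C(↥(pieceUp X ∩ pieceDn X), ℂ))ˣ) : C(↥(pieceUp X ∩ pieceDn X), ℂ)) = zAbar := rfl

/-- **Laurent polynomials** `∑ᵢ aᵢ(x) z^{eᵢ}` (`aᵢ ∈ C(X, ℂ)`, `eᵢ ∈ ℤ`) as functions on `X × S¹`
(Husemöller, Ch. 11 Def. 2.4). [cite: HusemollerFibreBundles1994, Ch. 11 Def. 2.4] -/
def IsLaurent (f : C(↥(pieceUp X ∩ pieceDn X), ℂ)) : Prop :=
  ∃ (ι : Type) (_ : Fintype ι) (g : ι → C(X, ℂ)) (e : ι → ℤ),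
    f = ∑ i, comapRingHom πA (g i) * ((zU ^ (e i) : (C(↥(pieceUp X ∩ pieceDn X), ℂ))ˣ) : C(_, ℂ))

namespace IsLaurent

/-- Auxiliary statement for Laurent approximation of clutching functions. [folklore] -/
theorem of_coeff (g : C(X, ℂ)) (k : ℤ) :
    IsLaurent (comapRingHom πA g * ((zU ^ k : (C(↥(pieceUp X ∩ pieceDn X), ℂ))ˣ) : C(_, ℂ))) :=
  ⟨Unit, inferInstance, fun _ ↦ g, fun _ ↦ k, by simp⟩

/-- Auxiliary statement for Laurent approximation of clutching functions. [folklore] -/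
theorem coeff (g : C(X, ℂ)) : IsLaurent (comapRingHom πA g : C(↥(pieceUp X ∩ pieceDn X), ℂ)) := by
  simpa using of_coeff g 0

/-- Auxiliary statement for Laurent approximation of clutching functions. [folklore] -/
theorem zero : IsLaurent (0 : C(↥(pieceUp X ∩ pieceDn X), ℂ)) :=
  ⟨Empty, inferInstance, Empty.elim, Empty.elim, by simp⟩

/-- Auxiliary statement for Laurent approximation of clutching functions. [folklore] -/
theorem one : IsLaurent (1 : C(↥(pieceUp X ∩ pieceDn X), ℂ)) := by
  simpa using coeff (X := X) 1

/-- Auxiliary statement for Laurent approximation of clutching functions. [folklore] -/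
theorem add {f f' : C(↥(pieceUp X ∩ pieceDn X), ℂ)} (hf : IsLaurent f) (hf' : IsLaurent f') : IsLaurent (f + f') := by
  obtain ⟨ι, _, g, e, rfl⟩ := hf
  obtain ⟨ι', _, g', e', rfl⟩ := hf'
  refine ⟨ι ⊕ ι', inferInstance, Sum.elim g g', Sum.elim e e', ?_⟩
  simp [Fintype.sum_sum_type]

/-- Auxiliary statement for Laurent approximation of clutching functions. [folklore] -/
theorem mul {f f' : C(↥(pieceUp X ∩ pieceDn X), ℂ)} (hf : IsLaurent f) (hf' : IsLaurent f') : IsLaurent (f * f') := by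
  obtain ⟨ι, _, g, e, rfl⟩ := hf
  obtain ⟨ι', _, g', e', rfl⟩ := hf'
  refine ⟨ι × ι', inferInstance, fun p ↦ g p.1 * g' p.2, fun p ↦ e p.1 + e' p.2, ?_⟩
  rw [Finset.sum_mul_sum, ← Finset.univ_product_univ, Finset.sum_product]
  refine Finset.sum_congr rfl fun i _ ↦ Finset.sum_congr rfl fun j _ ↦ ?_
  rw [map_mul, zpow_add, Units.val_mul]; ring

/-- Auxiliary statement for Laurent approximation of clutching functions. [folklore] -/
theorem smul (c : ℂ) {f : C(↥(pieceUp X ∩ pieceDn X), ℂ)} (hf : IsLaurent f) : IsLaurent (c • f) := by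
  have h : c • f = comapRingHom πA (algebraMap ℂ C(X, ℂ) c) * f := by
    ext z; change c • f z = (algebraMap ℂ C(X, ℂ) c) (πA z) * f z; simp [Algebra.algebraMap_eq_smul_one]
  rw [h]; exact (coeff _).mul hf

/-- Auxiliary statement for Laurent approximation of clutching functions. [folklore] -/
theorem star_zU_zpow (k : ℤ) :
    star (((zU ^ k : (C(↥(pieceUp X ∩ pieceDn X), ℂ))ˣ) : C(↥(pieceUp X ∩ pieceDn X), ℂ))) =
      ((zU ^ (-k) : (C(↥(pieceUp X ∩ pieceDn X), ℂ))ˣ) : C(_, ℂ)) := by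
  have h1 : star (zA : C(↥(pieceUp X ∩ pieceDn X), ℂ)) = zAbar := by ext z; rfl
  have hpos : ∀ n : ℕ, (((zU ^ (n : ℤ) : (C(↥(pieceUp X ∩ pieceDn X), ℂ))ˣ) : C(↥(pieceUp X ∩ pieceDn X), ℂ))) = zA ^ n :=
    fun n ↦ by rw [zpow_natCast, Units.val_pow_eq_pow_val, val_zU]
  have hneg : ∀ n : ℕ, (((zU ^ (-(n : ℤ)) : (C(↥(pieceUp X ∩ pieceDn X), ℂ))ˣ) : C(↥(pieceUp X ∩ pieceDn X), ℂ))) = zAbar ^ n :=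
    fun n ↦ by rw [zpow_neg, zpow_natCast, ← inv_pow, Units.val_pow_eq_pow_val, val_zU_inv]
  obtain ⟨n, rfl | rfl⟩ := k.eq_nat_or_neg
  · rw [hpos, hneg, star_pow, h1]
  · rw [neg_neg, hneg, hpos, star_pow, ← h1, star_star]

/-- Auxiliary statement for Laurent approximation of clutching functions. [folklore] -/
protected theorem star {f : C(↥(pieceUp X ∩ pieceDn X), ℂ)} (hf : IsLaurent f) : IsLaurent (Star.star f) := by
  obtain ⟨ι, _, g, e, rfl⟩ := hf
  refine ⟨ι, inferInstance, fun i ↦ Star.star (g i), fun i ↦ -e i, ?_⟩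
  rw [star_sum]
  refine Finset.sum_congr rfl fun i _ ↦ ?_
  rw [star_mul, star_zU_zpow, mul_comm]
  rfl

end IsLaurent

variable (X) in
/-- The **star subalgebra of Laurent polynomials** in `C(X × S¹, ℂ)`. [cite: HusemollerFibreBundles1994, Ch. 11 Def. 2.4] -/
def laurentStarSubalgebra : StarSubalgebra ℂ C(↥(pieceUp X ∩ pieceDn X), ℂ) where
  carrier := {f | IsLaurent f}
  mul_mem' := IsLaurent.mul
  one_mem' := IsLaurent.one
  add_mem' := IsLaurent.add
  zero_mem' := IsLaurent.zero
  algebraMap_mem' c := by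
    rw [Algebra.algebraMap_eq_smul_one]; exact IsLaurent.one.smul c
  star_mem' := IsLaurent.star

/-- Auxiliary statement for Laurent approximation of clutching functions. [folklore] -/
theorem mem_laurentStarSubalgebra {f : C(↥(pieceUp X ∩ pieceDn X), ℂ)} : f ∈ laurentStarSubalgebra X ↔ IsLaurent f := Iff.rfl

/-- The complex coordinate is injective on the equator. [folklore] -/
theorem zc_injOn_Eqt : InjOn zc Eqt := by
  intro x hx y hy hxy
  rw [mem_Eqt_iff] at hx hy
  rw [zc_apply, zc_apply, Complex.ext_iff] at hxy
  simp only [Complex.add_re, Complex.ofReal_re, Complex.mul_re, Complex.I_re, mul_zero, Complex.ofReal_im,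
    Complex.I_im, mul_one, sub_self, add_zero, Complex.add_im, Complex.mul_im, zero_add] at hxy
  apply Subtype.ext
  ext i
  fin_cases i
  · exact hxy.1
  · exact hxy.2
  · exact hx.trans hy.symm

/-- **Laurent polynomials separate the points of `X × S¹`** (`X` compact Hausdorff). [folklore] -/
theorem laurentStarSubalgebra_separatesPoints [CompactSpace X] [T2Space X] : (laurentStarSubalgebra X).SeparatesPoints := by
  intro a b hab
  by_cases hx : a.1.1 = b.1.1
  · -- same `x`: separate by `z`
    have hz : (zA : C(↥(pieceUp X ∩ pieceDn X), ℂ)) ∈ laurentStarSubalgebra X :=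
      mem_laurentStarSubalgebra.2 (by simpa using IsLaurent.of_coeff (X := X) 1 1)
    refine ⟨zA, ⟨zA, hz, rfl⟩, fun h ↦ hab ?_⟩
    have ha : a.1.2 ∈ Eqt := ⟨a.2.1.2, a.2.2.2⟩
    have hb : b.1.2 ∈ Eqt := ⟨b.2.1.2, b.2.2.2⟩
    exact Subtype.ext (Prod.ext hx (zc_injOn_Eqt ha hb h))
  · -- different `x`: separate by a function of `x` (Urysohn)
    haveI : NormalSpace X := inferInstance
    obtain ⟨g, hg0, hg1, -⟩ := exists_continuous_zero_one_of_isClosed (isClosed_singleton (x := a.1.1))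
      (isClosed_singleton (x := b.1.1)) (disjoint_singleton.2 hx)
    refine ⟨comapRingHom πA ((ContinuousMap.mk Complex.ofReal Complex.continuous_ofReal).comp g),
      ⟨_, IsLaurent.coeff _, rfl⟩, fun h ↦ ?_⟩
    have h0 := hg0 (mem_singleton a.1.1)
    have h1 := hg1 (mem_singleton b.1.1)
    change ((g a.1.1 : ℝ) : ℂ) = ((g b.1.1 : ℝ) : ℂ) at h
    rw [h0, h1] at h
    simp at h

/-- **Laurent polynomials are dense in `C(X × S¹, ℂ)`** (complex Stone–Weierstrass; Husemöller,
Ch. 11 Prop. 2.5, scalar case). [cite: HusemollerFibreBundles1994, Ch. 11 Prop. 2.5] -/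
theorem exists_isLaurent_near [CompactSpace X] [T2Space X] (f : C(↥(pieceUp X ∩ pieceDn X), ℂ)) {ε : ℝ} (hε : 0 < ε) :
    ∃ ℓ : C(↥(pieceUp X ∩ pieceDn X), ℂ), IsLaurent ℓ ∧ ‖f - ℓ‖ < ε := by
  have hd := ContinuousMap.starSubalgebra_topologicalClosure_eq_top_of_separatesPoints _
    (laurentStarSubalgebra_separatesPoints (X := X))
  have hf : f ∈ ((laurentStarSubalgebra X).topologicalClosure : Set C(↥(pieceUp X ∩ pieceDn X), ℂ)) := by
    rw [hd]; trivial
  rw [StarSubalgebra.topologicalClosure_coe, Metric.mem_closure_iff] at hf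
  obtain ⟨ℓ, hℓ, hfl⟩ := hf ε hε
  exact ⟨ℓ, hℓ, by rwa [dist_eq_norm] at hfl⟩


/-! ### Matrix Laurent polynomials and the operator norm -/

section MatrixNorm

attribute [local instance] Matrix.linftyOpNormedRing Matrix.linftyOpNormedAlgebra

/-- Entrywise bound ⇒ operator-norm bound. [folklore] -/
theorem linfty_opNorm_le_card_mul {R : Type*} [NormedRing R] {n : Type*} [Fintype n] [DecidableEq n] (M : Matrix n n R) {c : ℝ}
    (_hc : 0 ≤ c) (h : ∀ i j, ‖M i j‖ ≤ c) : ‖M‖ ≤ Fintype.card n * c := by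
  rw [Matrix.linfty_opNorm_def]
  have key : ∀ i, ((∑ j, ‖M i j‖₊ : NNReal) : ℝ) ≤ Fintype.card n * c := fun i ↦ by
    push_cast
    calc ∑ j, ‖M i j‖ ≤ ∑ _j : n, c := Finset.sum_le_sum fun j _ ↦ h i j
      _ = Fintype.card n * c := by rw [Finset.sum_const, Finset.card_univ, nsmul_eq_mul]
  obtain hn | hn := isEmpty_or_nonempty n
  · simp
  · obtain ⟨i, -, hi⟩ := Finset.exists_mem_eq_sup (Finset.univ : Finset n) Finset.univ_nonempty fun i ↦ ∑ j, ‖M i j‖₊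
    rw [hi]; exact key i

/-- The entries are bounded by the operator norm. [folklore] -/
theorem norm_entry_le_linfty_opNorm {R : Type*} [NormedRing R] {n : Type*} [Fintype n] [DecidableEq n] (M : Matrix n n R) (i j : n) :
    ‖M i j‖ ≤ ‖M‖ := by
  rw [Matrix.linfty_opNorm_def]
  have h1 : (‖M i j‖₊ : NNReal) ≤ ∑ j', ‖M i j'‖₊ :=
    Finset.single_le_sum (f := fun j' ↦ ‖M i j'‖₊) (fun _ _ ↦ zero_le) (Finset.mem_univ j)
  have h2 : (∑ j', ‖M i j'‖₊) ≤ (Finset.univ.sup fun i ↦ ∑ j, ‖M i j‖₊ : NNReal) :=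
    Finset.le_sup (f := fun i ↦ ∑ j, ‖M i j‖₊) (Finset.mem_univ i)
  exact_mod_cast h1.trans h2

end MatrixNorm

/-- **Matrix Laurent polynomials** `∑ᵢ z^{eᵢ} Aᵢ(x)` with `Aᵢ ∈ Mₙ(C(X, ℂ))`. [cite: HusemollerFibreBundles1994, Ch. 11 Def. 2.4] -/
def laurentMatrix {n : ℕ} {ι : Type} [Fintype ι] (A : ι → Matrix (Fin n) (Fin n) C(X, ℂ)) (e : ι → ℤ) :
    Matrix (Fin n) (Fin n) C(↥(pieceUp X ∩ pieceDn X), ℂ) :=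
  ∑ i, (((zU ^ (e i) : (C(↥(pieceUp X ∩ pieceDn X), ℂ))ˣ) : C(↥(pieceUp X ∩ pieceDn X), ℂ)) • (A i).map (comapRingHom πA))

/-- Auxiliary statement for Laurent approximation of clutching functions. [folklore] -/
theorem laurentMatrix_apply {n : ℕ} {ι : Type} [Fintype ι] (A : ι → Matrix (Fin n) (Fin n) C(X, ℂ)) (e : ι → ℤ) (p q : Fin n) :
    laurentMatrix A e p q = ∑ i, comapRingHom πA (A i p q) * ((zU ^ (e i) : (C(↥(pieceUp X ∩ pieceDn X), ℂ))ˣ) : C(_, ℂ)) := by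
  simp only [laurentMatrix, Matrix.sum_apply, Matrix.smul_apply, Matrix.map_apply, smul_eq_mul]
  exact Finset.sum_congr rfl fun i _ ↦ mul_comm _ _

section Approx

attribute [local instance] Matrix.linftyOpNormedRing Matrix.linftyOpNormedAlgebra

/-- **Laurent approximation of matrix functions on `X × S¹`** (Husemöller, Ch. 11 Prop. 2.5): every
`u ∈ Mₙ(C(X × S¹, ℂ))` is within any `ε > 0` of a matrix Laurent polynomial `∑ᵢ z^{eᵢ} Aᵢ(x)`.
[cite: HusemollerFibreBundles1994, Ch. 11 Prop. 2.5] -/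
theorem exists_laurentMatrix_near [CompactSpace X] [T2Space X] {n : ℕ} (u : Matrix (Fin n) (Fin n) C(↥(pieceUp X ∩ pieceDn X), ℂ))
    {ε : ℝ} (hε : 0 < ε) :
    ∃ (ι : Type) (_ : Fintype ι) (A : ι → Matrix (Fin n) (Fin n) C(X, ℂ)) (e : ι → ℤ), ‖u - laurentMatrix A e‖ < ε := by
  -- entrywise approximation to within `ε / (n + 1)`
  have hε' : 0 < ε / (n + 1) := by positivity
  choose ℓ hℓ hdist using fun p q ↦ exists_isLaurent_near (u p q) hε'
  choose ι hfin g e hge using hℓ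
  refine ⟨Σ pq : Fin n × Fin n, ι pq.1 pq.2, inferInstance,
    fun s ↦ Matrix.single s.1.1 s.1.2 (g s.1.1 s.1.2 s.2), fun s ↦ e s.1.1 s.1.2 s.2, ?_⟩
  have hentry : ∀ p q, (u - laurentMatrix (fun s : Σ pq : Fin n × Fin n, ι pq.1 pq.2 ↦ Matrix.single s.1.1 s.1.2 (g s.1.1 s.1.2 s.2))
      (fun s ↦ e s.1.1 s.1.2 s.2)) p q = u p q - ℓ p q := by
    intro p q
    rw [Matrix.sub_apply, laurentMatrix_apply, hge p q]
    congr 1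
    rw [Fintype.sum_sigma]
    rw [Fintype.sum_eq_single (p, q)]
    · exact Finset.sum_congr rfl fun i _ ↦ by rw [Matrix.single_apply_same]
    · rintro ⟨p', q'⟩ hne
      apply Finset.sum_eq_zero
      intro i _
      rw [Matrix.single_apply_of_ne, map_zero, zero_mul]
      exact fun h ↦ hne (Prod.ext h.1 h.2)
  calc ‖u - laurentMatrix _ _‖ ≤ Fintype.card (Fin n) * (ε / (n + 1)) :=
        linfty_opNorm_le_card_mul _ hε'.le fun p q ↦ by rw [hentry]; exact (hdist p q).le
    _ < ε := by
        rw [Fintype.card_fin]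
        calc (n : ℝ) * (ε / (n + 1)) < (n + 1) * (ε / (n + 1)) := by gcongr; linarith
          _ = ε := by field_simp

end Approx

/-! ### Small perturbations of clutching functions (Husemöller Ch. 11 Prop. 2.6) -/

section Perturb

attribute [local instance] Matrix.linftyOpNormedRing Matrix.linftyOpNormedAlgebra

/-- Completeness of `Mₙ(C(X × S¹, ℂ))` for the operator norm (the uniformity is the product one). [folklore] -/
instance completeSpace_overlapMatrix [CompactSpace X] (n : ℕ) :
    @CompleteSpace (Matrix (Fin n) (Fin n) C(↥(pieceUp X ∩ pieceDn X), ℂ)) PseudoMetricSpace.toUniformSpace :=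
  (inferInstance : @CompleteSpace (Matrix (Fin n) (Fin n) C(↥(pieceUp X ∩ pieceDn X), ℂ)) (Matrix.instUniformSpace _ _ _))

/-- Auxiliary statement for Laurent approximation of clutching functions. -/
instance hasSummableGeomSeries_overlapMatrix [CompactSpace X] (n : ℕ) :
    HasSummableGeomSeries (Matrix (Fin n) (Fin n) C(↥(pieceUp X ∩ pieceDn X), ℂ)) := inferInstance

variable [CompactSpace X] {ζ : Idem C(X, ℂ)}

namespace ClutchingFn

omit [CompactSpace X] in
/-- `Z δ = δ` for `δ = Z δ Z`. [folklore] -/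
theorem pullA_mul_of_eq {δ : Matrix (Fin ζ.size) (Fin ζ.size) C(↥(pieceUp X ∩ pieceDn X), ℂ)} (hδ : pullA ζ * δ * pullA ζ = δ) :
    pullA ζ * δ = δ := by
  conv_lhs => rw [← hδ]
  rw [← Matrix.mul_assoc, ← Matrix.mul_assoc, (isIdempotentElem_pullA ζ).eq, hδ]

omit [CompactSpace X] in
/-- `δ Z = δ` for `δ = Z δ Z`. [folklore] -/
theorem mul_pullA_of_eq {δ : Matrix (Fin ζ.size) (Fin ζ.size) C(↥(pieceUp X ∩ pieceDn X), ℂ)} (hδ : pullA ζ * δ * pullA ζ = δ) :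
    δ * pullA ζ = δ := by
  conv_lhs => rw [← hδ]
  rw [Matrix.mul_assoc, (isIdempotentElem_pullA ζ).eq, hδ]

/-- The unit `1 + v δ` of a small perturbation. [folklore] -/
def perturbUnit (c : ClutchingFn ζ) (δ : Matrix (Fin ζ.size) (Fin ζ.size) C(↥(pieceUp X ∩ pieceDn X), ℂ))
    (hsmall : ‖c.v‖ * ‖δ‖ < 1) : (Matrix (Fin ζ.size) (Fin ζ.size) C(↥(pieceUp X ∩ pieceDn X), ℂ))ˣ :=
  Units.oneSub (-(c.v * δ)) (by rw [norm_neg]; exact (Matrix.linfty_opNorm_mul _ _).trans_lt hsmall)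

/-- Auxiliary statement for Laurent approximation of clutching functions. [folklore] -/
theorem val_perturbUnit (c : ClutchingFn ζ) (δ : Matrix (Fin ζ.size) (Fin ζ.size) C(↥(pieceUp X ∩ pieceDn X), ℂ))
    (hsmall : ‖c.v‖ * ‖δ‖ < 1) : (c.perturbUnit δ hsmall : Matrix _ _ _) = 1 + c.v * δ := by
  rw [perturbUnit, Units.val_oneSub, sub_neg_eq_add]

/-- **Small perturbation of a clutching function** (Husemöller, Ch. 11 Prop. 2.6: clutching maps
sufficiently close to a clutching map are clutching maps): `u + δ` with `δ = Z δ Z` and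
`‖v‖ ‖δ‖ < 1` is again an automorphism of `im π^* ζ`, with inverse `(1 + v δ)⁻¹ v` (Neumann
series). [cite: HusemollerFibreBundles1994, Ch. 11 Prop. 2.6] -/
def perturb (c : ClutchingFn ζ) (δ : Matrix (Fin ζ.size) (Fin ζ.size) C(↥(pieceUp X ∩ pieceDn X), ℂ))
    (hδ : pullA ζ * δ * pullA ζ = δ) (hsmall : ‖c.v‖ * ‖δ‖ < 1) : ClutchingFn ζ where
  u := c.u + δ
  v := ((c.perturbUnit δ hsmall)⁻¹ : (Matrix (Fin ζ.size) (Fin ζ.size) C(↥(pieceUp X ∩ pieceDn X), ℂ))ˣ) * c.v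
  hu := by rw [Matrix.mul_add, Matrix.add_mul, c.hu, hδ]
  hv := by
    set w := c.perturbUnit δ hsmall
    have hcomm : Commute (pullA ζ) (w : Matrix _ _ _) := by
      rw [Commute, SemiconjBy, val_perturbUnit, Matrix.mul_add, Matrix.add_mul, Matrix.mul_one, Matrix.one_mul,
        ← Matrix.mul_assoc, c.pullA_mul_v, Matrix.mul_assoc, mul_pullA_of_eq hδ]
    rw [Matrix.mul_assoc, Matrix.mul_assoc, c.v_mul_pullA, ← Matrix.mul_assoc, hcomm.units_inv_right.eq, Matrix.mul_assoc,
      c.pullA_mul_v]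
  huv := by
    set w := c.perturbUnit δ hsmall
    have h1 : c.u + δ = c.u * (w : Matrix _ _ _) := by
      rw [val_perturbUnit, Matrix.mul_add, Matrix.mul_one, ← Matrix.mul_assoc, c.huv, pullA_mul_of_eq hδ]
    rw [h1, Matrix.mul_assoc, Units.mul_inv_cancel_left, c.huv]
  hvu := by
    set w := c.perturbUnit δ hsmall
    have h1 : c.v * (c.u + δ) = (w : Matrix _ _ _) * pullA ζ := by
      rw [val_perturbUnit, Matrix.mul_add, Matrix.add_mul, Matrix.one_mul, c.hvu, Matrix.mul_assoc, mul_pullA_of_eq hδ]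
    rw [Matrix.mul_assoc, h1, Units.inv_mul_cancel_left]

/-- Auxiliary statement for Laurent approximation of clutching functions. [folklore] -/
theorem perturb_u (c : ClutchingFn ζ) (δ : Matrix (Fin ζ.size) (Fin ζ.size) C(↥(pieceUp X ∩ pieceDn X), ℂ))
    (hδ : pullA ζ * δ * pullA ζ = δ) (hsmall : ‖c.v‖ * ‖δ‖ < 1) : (c.perturb δ hδ hsmall).u = c.u + δ := rfl

end ClutchingFn

end Perturb

/-! ### The linear homotopy `u + s δ` and Laurent approximation of clutching functions -/

section LinearHomotopy

attribute [local instance] Matrix.linftyOpNormedRing Matrix.linftyOpNormedAlgebra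

/-- Entrywise domination ⇒ operator-norm domination. [folklore] -/
theorem linfty_opNorm_mono {R S : Type*} [NormedRing R] [NormedRing S] {n : Type*} [Fintype n] [DecidableEq n]
    (M : Matrix n n R) (N : Matrix n n S) (h : ∀ i j, ‖N i j‖ ≤ ‖M i j‖) : ‖N‖ ≤ ‖M‖ := by
  rw [Matrix.linfty_opNorm_def, Matrix.linfty_opNorm_def]
  have key : (Finset.univ.sup fun i ↦ ∑ j, ‖N i j‖₊ : NNReal) ≤ Finset.univ.sup fun i ↦ ∑ j, ‖M i j‖₊ :=
    Finset.sup_mono_fun fun i _ ↦ Finset.sum_le_sum fun j _ ↦ (show ‖N i j‖₊ ≤ ‖M i j‖₊ from h i j)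
  exact_mod_cast key

/-- Pulling back along a map does not increase the operator norm. [folklore] -/
theorem linfty_opNorm_map_comapRingHom_le {A A' : Type*} [TopologicalSpace A] [CompactSpace A] [TopologicalSpace A']
    [CompactSpace A'] (F : C(A', A)) {n : Type*} [Fintype n] [DecidableEq n] (M : Matrix n n C(A, ℂ)) :
    ‖M.map (comapRingHom F)‖ ≤ ‖M‖ := by
  refine linfty_opNorm_mono M _ fun i j ↦ ?_
  rw [Matrix.map_apply, ContinuousMap.norm_le _ (norm_nonneg _)]
  intro a
  exact (M i j).norm_coe_le_norm (F a)

variable [CompactSpace X] [T2Space X] {ζ : Idem C(X, ℂ)}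

/-- The parameter `s ∈ [0,1]` as a scalar function on `(X × [0,1]) × S¹`. [folklore] -/
def sCoord : C(↥(pieceUp (X × I) ∩ pieceDn (X × I)), ℂ) :=
  ⟨fun z ↦ ((z.1.1.2 : ℝ) : ℂ), by fun_prop⟩

omit [CompactSpace X] [T2Space X] in
/-- Auxiliary statement for Laurent approximation of clutching functions. [folklore] -/
@[simp] theorem sCoord_apply (z : ↥(pieceUp (X × I) ∩ pieceDn (X × I))) : sCoord z = ((z.1.1.2 : ℝ) : ℂ) := rfl

omit [CompactSpace X] [T2Space X] in
/-- Auxiliary statement for Laurent approximation of clutching functions. [folklore] -/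
theorem norm_sCoord_apply_le (z : ↥(pieceUp (X × I) ∩ pieceDn (X × I))) : ‖sCoord (X := X) z‖ ≤ 1 := by
  rw [sCoord_apply, Complex.norm_real, Real.norm_eq_abs, abs_le]
  exact ⟨by linarith [z.1.1.2.2.1], z.1.1.2.2.2⟩

omit [T2Space X] in
/-- `‖s • N‖ ≤ ‖N‖`. [folklore] -/
theorem linfty_opNorm_sCoord_smul_le {n : Type*} [Fintype n] [DecidableEq n]
    (N : Matrix n n C(↥(pieceUp (X × I) ∩ pieceDn (X × I)), ℂ)) : ‖(sCoord (X := X)) • N‖ ≤ ‖N‖ := by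
  refine linfty_opNorm_mono N _ fun i j ↦ ?_
  rw [Matrix.smul_apply, smul_eq_mul, ContinuousMap.norm_le _ (norm_nonneg _)]
  intro z
  rw [ContinuousMap.mul_apply, norm_mul]
  calc ‖sCoord z‖ * ‖N i j z‖ ≤ 1 * ‖N i j‖ := by
        gcongr
        · exact norm_sCoord_apply_le z
        · exact (N i j).norm_coe_le_norm z
    _ = ‖N i j‖ := one_mul _

/-- The restriction of `fst × id : (X × [0,1]) × S² → X × S²` to the overlaps. [folklore] -/
abbrev fstOverlap : C(↥(pieceUp (X × I) ∩ pieceDn (X × I)), ↥(pieceUp X ∩ pieceDn X)) :=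
  restrictMap (baseMap (ContinuousMap.fst : C(X × I, X)))
    (mapsTo_inter (mapsTo_baseMap_pieceUp _) (mapsTo_baseMap_pieceDn _))

/-- The restriction of `i_t × id : X × S² → (X × [0,1]) × S²` to the overlaps. [folklore] -/
abbrev sliceOverlap (t : I) : C(↥(pieceUp X ∩ pieceDn X), ↥(pieceUp (X × I) ∩ pieceDn (X × I))) :=
  restrictMap (baseMap (sliceIncl t)) (mapsTo_inter (mapsTo_baseMap_pieceUp _) (mapsTo_baseMap_pieceDn _))

omit [CompactSpace X] [T2Space X] in
/-- Auxiliary statement for Laurent approximation of clutching functions. [folklore] -/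
theorem fstOverlap_comp_sliceOverlap (t : I) : (fstOverlap (X := X)).comp (sliceOverlap t) = ContinuousMap.id _ := by
  ext z <;> rfl

omit [CompactSpace X] [T2Space X] in
/-- Auxiliary statement for Laurent approximation of clutching functions. [folklore] -/
theorem map_fstOverlap_map_sliceOverlap {n : Type*} (M : Matrix n n C(↥(pieceUp X ∩ pieceDn X), ℂ)) (t : I) :
    (M.map (comapRingHom fstOverlap)).map (comapRingHom (sliceOverlap t)) = M := by
  rw [Matrix.map_map, ← RingHom.coe_comp, ← comapRingHom_comp, fstOverlap_comp_sliceOverlap, comapRingHom_id]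
  exact Matrix.map_id M

omit [CompactSpace X] [T2Space X] in
/-- Auxiliary statement for Laurent approximation of clutching functions. [folklore] -/
theorem sCoord_comp_sliceOverlap (t : I) : (sCoord (X := X)).comp (sliceOverlap t) = ContinuousMap.const _ ((t : ℝ) : ℂ) := by
  ext z; rfl

omit [CompactSpace X] [T2Space X] in
/-- The perturbation `s δ` over `X × [0,1]` is supported on `im π^* ζ`. [folklore] -/
theorem linearHomotopy_hδ {δ : Matrix (Fin ζ.size) (Fin ζ.size) C(↥(pieceUp X ∩ pieceDn X), ℂ)} (hδ : pullA ζ * δ * pullA ζ = δ) :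
    (pullA ζ).map (comapRingHom fstOverlap) * ((sCoord (X := X)) • δ.map (comapRingHom fstOverlap)) *
        (pullA ζ).map (comapRingHom fstOverlap) =
      (sCoord (X := X)) • δ.map (comapRingHom fstOverlap) := by
  have h := congrArg (fun M ↦ M.map (comapRingHom (fstOverlap (X := X)))) hδ
  simp only [Matrix.map_mul] at h
  have e1 := Matrix.mul_smul ((pullA ζ).map (comapRingHom fstOverlap)) (sCoord (X := X)) (δ.map (comapRingHom fstOverlap))
  have e2 := Matrix.smul_mul (sCoord (X := X)) ((pullA ζ).map (comapRingHom fstOverlap) * δ.map (comapRingHom fstOverlap))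
    ((pullA ζ).map (comapRingHom fstOverlap))
  rw [e1, e2, h]

omit [T2Space X] in
/-- The perturbation `s δ` is small when `δ` is. [folklore] -/
theorem linearHomotopy_hsmall (c : ClutchingFn ζ) {δ : Matrix (Fin ζ.size) (Fin ζ.size) C(↥(pieceUp X ∩ pieceDn X), ℂ)}
    (hsmall : ‖c.v‖ * ‖δ‖ < 1) :
    ‖c.v.map (comapRingHom (fstOverlap (X := X)))‖ * ‖(sCoord (X := X)) • δ.map (comapRingHom fstOverlap)‖ < 1 :=
  (mul_le_mul (linfty_opNorm_map_comapRingHom_le _ _)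
    ((linfty_opNorm_sCoord_smul_le _).trans (linfty_opNorm_map_comapRingHom_le _ _)) (norm_nonneg _) (norm_nonneg _)).trans_lt
    hsmall

/-- **The linear homotopy of clutching functions `u + s δ`, `s ∈ [0,1]`** as a clutching function of
`pr₁^* ζ` over `X × [0,1]`. [cite: HusemollerFibreBundles1994, Ch. 11 Prop. 2.6] -/
def ClutchingFn.linearHomotopy (c : ClutchingFn ζ) (δ : Matrix (Fin ζ.size) (Fin ζ.size) C(↥(pieceUp X ∩ pieceDn X), ℂ))
    (hδ : pullA ζ * δ * pullA ζ = δ) (hsmall : ‖c.v‖ * ‖δ‖ < 1) :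
    ClutchingFn (ζ.map (comapRingHom (ContinuousMap.fst : C(X × I, X)))) :=
  (c.baseChange ContinuousMap.fst).perturb (sCoord • δ.map (comapRingHom fstOverlap))
    (by rw [pullA_map]; exact linearHomotopy_hδ hδ) (linearHomotopy_hsmall c hsmall)

omit [T2Space X] in
/-- The slices of the linear homotopy are `u + t δ`. [cite: HusemollerFibreBundles1994, Ch. 11 Prop. 2.6] -/
theorem ClutchingFn.linearHomotopy_slice_u (c : ClutchingFn ζ) (δ : Matrix (Fin ζ.size) (Fin ζ.size) C(↥(pieceUp X ∩ pieceDn X), ℂ))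
    (hδ : pullA ζ * δ * pullA ζ = δ) (hsmall : ‖c.v‖ * ‖δ‖ < 1) (t : I) :
    ((c.linearHomotopy δ hδ hsmall).baseChange (sliceIncl t)).u = c.u + (((t : ℝ) : ℂ) • δ : Matrix _ _ _) := by
  ext i j z
  rfl

/-- **Small perturbations do not change the Bott class** (`[ζ, u] = [ζ, u + δ]`, Husemöller Ch. 11
Prop. 2.6 with (2.3)). [cite: HusemollerFibreBundles1994, Ch. 11 Prop. 2.6] -/
theorem ClutchingFn.bottClass_perturb (c : ClutchingFn ζ) (δ : Matrix (Fin ζ.size) (Fin ζ.size) C(↥(pieceUp X ∩ pieceDn X), ℂ))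
    (hδ : pullA ζ * δ * pullA ζ = δ) (hsmall : ‖c.v‖ * ‖δ‖ < 1) :
    bottClass ζ (c.perturb δ hδ hsmall) = bottClass ζ c := by
  refine (bottClass_eq_of_homotopy ζ c (c.perturb δ hδ hsmall) (c.linearHomotopy δ hδ hsmall) ?_ ?_).symm
  · rw [c.linearHomotopy_slice_u]; simp
  · rw [c.linearHomotopy_slice_u, ClutchingFn.perturb_u]; simp

/-- **Laurent approximation of clutching functions** (Husemöller, Ch. 11 Props. 2.5–2.6 with 2.3):
every clutching function `u` of `ζ` has the same Bott class as a *Laurent polynomial clutching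
function* `Z (∑ᵢ z^{eᵢ} Aᵢ(x)) Z`. [cite: HusemollerFibreBundles1994, Ch. 11 Prop. 2.6] -/
theorem ClutchingFn.exists_laurent_bottClass_eq (c : ClutchingFn ζ) :
    ∃ (ι : Type) (_ : Fintype ι) (A : ι → Matrix (Fin ζ.size) (Fin ζ.size) C(X, ℂ)) (e : ι → ℤ) (c' : ClutchingFn ζ),
      c'.u = pullA ζ * laurentMatrix A e * pullA ζ ∧ bottClass ζ c' = bottClass ζ c := by
  set Z := pullA ζ with hZdef
  have hZ : Z * Z = Z := (isIdempotentElem_pullA ζ).eq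
  set K : ℝ := (‖c.v‖ + 1) * (‖Z‖ + 1) ^ 2
  have hK : 0 < K := by positivity
  obtain ⟨ι, _, A, e, hL⟩ := exists_laurentMatrix_near c.u (ε := 1 / K) (by positivity)
  set L := laurentMatrix A e
  set δ := Z * L * Z - c.u
  have hδ' : δ = Z * (L - c.u) * Z := by
    simp only [δ, Matrix.mul_sub, Matrix.sub_mul]
    rw [hZdef, c.hu]
  have hδ : Z * δ * Z = δ := by
    rw [hδ', ← Matrix.mul_assoc, ← Matrix.mul_assoc, hZ, Matrix.mul_assoc _ Z Z, hZ]
  have hnorm : ‖δ‖ ≤ ‖Z‖ * ‖L - c.u‖ * ‖Z‖ := by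
    rw [hδ']
    exact (Matrix.linfty_opNorm_mul _ _).trans (mul_le_mul_of_nonneg_right (Matrix.linfty_opNorm_mul _ _) (norm_nonneg _))
  have hLu : ‖L - c.u‖ < 1 / K := by rwa [← norm_neg, neg_sub]
  have hsmall : ‖c.v‖ * ‖δ‖ < 1 := by
    have h1 : ‖c.v‖ * ‖δ‖ ≤ ‖c.v‖ * (‖Z‖ * (1 / K) * ‖Z‖) := by
      refine mul_le_mul_of_nonneg_left (hnorm.trans ?_) (norm_nonneg _)
      gcongr
    refine h1.trans_lt ?_
    rw [show ‖c.v‖ * (‖Z‖ * (1 / K) * ‖Z‖) = ‖c.v‖ * ‖Z‖ ^ 2 / K by ring, div_lt_one hK]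
    have hv := norm_nonneg c.v
    have hz := norm_nonneg Z
    simp only [K]
    nlinarith
  refine ⟨ι, inferInstance, A, e, c.perturb δ hδ hsmall, ?_, c.bottClass_perturb δ hδ hsmall⟩
  rw [ClutchingFn.perturb_u]
  simp only [δ]; abel

end LinearHomotopy

end Literature.AlgebraicTopology.KTheory

end
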